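import Summits.BirchSwinnertonDyer.BirchSwinnertonDyer.Theorems.GenusKolyvaginAtTwoK4NegOffCutPhantomSelmerDichotomy
import Summits.BirchSwinnertonDyer.BirchSwinnertonDyer.Theorems.GenusKolyvaginAtTwoK4PosGoodSupersingularHabitatEmpty
import Literature.NumberTheory.EllipticCurves.BinaryQuarticStabilizerTorsion
import Literature.NumberTheory.EllipticCurves.LocalPointsPlaceTransportProofs
import HarnessLib

/-!
# Route `GenusKolyvaginAtTwo`, K₄⁻ kernel `K4Neg` (stmt-BirchSwinnertonDyer-31526), LINE 34 v1.4 (F4ˢˢ / T_C habitat):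
# GOOD SUPERSINGULAR REDUCTION AT 2 ⟹ `E(ℚ₂)[2] = 0`, and the sharp 2-adic bit ★★★ on the good-supersingular cell BY NAME

Width seat `bsd-line-gk2-p4` g33 (cell `bsd-f1-sign2`); `--supports stmt-BirchSwinnertonDyer-31526 --as helper`.  THEOREMS ONLY (no definition,
no named fact, no `sorry`); standard axioms.  **BSD is NOT proved by this file; `K4Neg` is NOT proved; no item is closed by it.**

WHAT.  The pen's T_C / F4ˢˢ habitat (LINE 34 v1.4) and this seat's memos `LOCAL-PHANTOMS-FLAT-SS-gk2p4-g33.md` (REF1 §386 PASS) /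
`ORDINARY-PHANTOM-BIT-gk2p4-g33.md` use «good supersingular at `2` ⟹ `E(ℚ₂)[2] = 0`» (memo (F3)/(F4)).  Kernel form:
* §1 `two_dvd_a₁_of_goodSS`, `not_two_dvd_a₃_of_goodSS` — on a globally minimal model, good SUPERSINGULAR reduction at `2` forces `a₁` even
  and `a₃` odd (the LEAD's S1 argument, gk2-p1 g28 `GoodSSHabitat.two_dvd_reductionPointCount_of_odd_a₁`: an odd `a₁` puts a rational
  `2`-torsion point on the reduction, making `#Ẽ(𝔽₂)` even and `a₂` odd; then `Δ` odd forces `a₃` odd), hence `4 ∣ b₂`, `2 ∣ b₄`, `2 ∤ b₆`.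
* §2 `twoDivisionCubic_ne_zero_of_dvd` — ultrametric: for integers `4 ∣ b₂`, `2 ∣ b₄`, `2 ∤ b₆` the `2`-division cubic `4x³ + b₂x² + 2b₄x + b₆`
  has NO root in `ℚ₂` (`‖x‖ ≤ 1`: the odd constant dominates; `‖x‖ ≥ 2`: `4x³` dominates).
* §3 ★ `forall_two_nsmul_eq_zero_padic_of_goodSS` — **`E(ℚ₂)[2] = 0`** (`∀ Q ∈ E(ℚ₂), 2Q = O → Q = O`, Mathlib's `ℚ_[2]`), via
  `#E(F)[2] = #{roots of ψ₂} + 1` (`WeierstrassCurve.natCard_torsionBy_two_eq`, gk2-p5 g6 bridge `isRoot_twoTorsionPolynomial_baseChange_padic_iff`);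
  `natCard_ker_two_adicCompletion_eq_one_of_goodSS` — the same in the place currency `#ker(2 : E(ℚ_{v₂})) = 1` of the Selmer files.
* §4 ★★★ `nonPhantom_pow_iff_strict_and_forall_localization_ne_zero_of_goodSS` — this seat's sharp bit (p784198
  `TwoAdic.nonPhantom_pow_iff_strict_and_forall_localization_ne_zero`) with its binder `E(ℚ₂)[2] = 0` DISCHARGED on the good-supersingular off-cut
  `Δ < 0` cell: there **`(NPh_M ∀M)(E, K)` ⟺ «`Sel₂(E)` 2-adically strict ∧ every non-zero phantom has `res_{v₂} ≠ 0`»** — the exact content of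
  F4″ on the pen's F4ˢˢ/T_C habitat (by the paper lemma LPF₂ the right-hand side is in fact always FALSE there; that part is not a kernel theorem).
BSD is NOT proved by any of this.

References: [SilvermanAEC2009] III.1 (b-invariants, `ψ₂`), VII.5.1, App. A Prop. 1.1; [MilneADT2006] I Lemma 3.3; [LawsonWuthrich2016] §7.1.
-/

set_option autoImplicit false
set_option linter.dupNamespace false -- `Summit.<P>.<Sub>` repeats `BirchSwinnertonDyer` (D-0017)

noncomputable section

open scoped Classical NumberField

namespace Summit.BirchSwinnertonDyer.BirchSwinnertonDyer.Theorems.GenusExact.Lw2PhantomExclusion.TwoAdic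

open WeierstrassCurve Field NumberField IsDedekindDomain Rat.HeightOneSpectrum
open Literature.NumberTheory.EllipticCurves Literature.NumberTheory.GaloisRepresentations
open Summit.BirchSwinnertonDyer.BirchSwinnertonDyer.Theorems.GenusExact.VisiblePairAtTwo (natCast_prime_mem_iff_eq)

/-! ## §1 Good supersingular reduction at `2`: `a₁` even, `a₃` odd on the minimal model -/

section Parity

variable (W : WeierstrassCurve ℚ) [W.IsElliptic] [W.IsGloballyMinimal]

omit [W.IsElliptic] in
/-- **Good supersingular reduction at `2` ⟹ `2 ∣ a₁`** on the integral minimal model: were `a₁` odd, the reduction mod `2` would carry the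
rational point `(ā₃, ȳ)` of order `2` (gk2-p1 g28 `GoodSSHabitat.two_dvd_reductionPointCount_of_odd_a₁`), so `#Ẽ(𝔽₂)` would be even and
`a₂ = 3 − #Ẽ(𝔽₂)` odd. [cite: SilvermanAEC2009, VII.5.1 and App. A Prop. 1.1] -/
theorem two_dvd_a₁_of_goodSS (hss : Literature.NumberTheory.EllipticCurves.Rank1Residual.GoodSS W 2) :
    (2 : ℤ) ∣ (integralModelInt W).a₁ := by
  obtain ⟨hgood, hap⟩ := hss
  have hodd : ¬ (2 : ℤ) ∣ minimalDiscriminantInt W :=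
    W.not_dvd_minimalDiscriminantInt_of_hasGoodReductionAtPrime' 2 hgood
  by_contra h1
  obtain ⟨k, hk⟩ := GoodSSHabitat.two_dvd_reductionPointCount_of_odd_a₁ W hodd h1
  obtain ⟨j, hj⟩ := hap
  rw [frobeniusTrace, hk] at hj
  push_cast at hj
  omega

omit [W.IsElliptic] in
/-- **Good supersingular reduction at `2` ⟹ `2 ∤ a₃`** on the integral minimal model: with `a₁ = 2α`, an even `a₃` would make
`Δ = −b₂²b₈ − 8b₄³ − 27b₆² + 9b₂b₄b₆` even (`4 ∣ b₂`, `2 ∣ b₄`, `4 ∣ b₆`), contradicting good reduction at `2`.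
[cite: SilvermanAEC2009, III.1 and VII.5.1] -/
theorem not_two_dvd_a₃_of_goodSS (hss : Literature.NumberTheory.EllipticCurves.Rank1Residual.GoodSS W 2) :
    ¬ (2 : ℤ) ∣ (integralModelInt W).a₃ := by
  have hodd : ¬ (2 : ℤ) ∣ minimalDiscriminantInt W :=
    W.not_dvd_minimalDiscriminantInt_of_hasGoodReductionAtPrime' 2 hss.1
  obtain ⟨α, hα⟩ := two_dvd_a₁_of_goodSS W hss
  set M : WeierstrassCurve ℤ := integralModelInt W with hM
  have hΔM : minimalDiscriminantInt W = M.Δ := rfl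
  rintro ⟨γ', hγ'⟩
  apply hodd
  rw [hΔM]
  have hb2 : M.b₂ = 4 * (α ^ 2 + M.a₂) := by rw [WeierstrassCurve.b₂, hα]; ring
  have hb4 : M.b₄ = 2 * (M.a₄ + 2 * α * γ') := by rw [WeierstrassCurve.b₄, hα, hγ']; ring
  have hb6 : M.b₆ = 4 * (γ' ^ 2 + M.a₆) := by rw [WeierstrassCurve.b₆, hγ']; ring
  refine ⟨-8 * (α ^ 2 + M.a₂) ^ 2 * M.b₈ - 32 * (M.a₄ + 2 * α * γ') ^ 3 - 216 * (γ' ^ 2 + M.a₆) ^ 2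
    + 144 * (α ^ 2 + M.a₂) * (M.a₄ + 2 * α * γ') * (γ' ^ 2 + M.a₆), ?_⟩
  rw [WeierstrassCurve.Δ, hb2, hb4, hb6]; ring

omit [W.IsElliptic] in
/-- **Good supersingular reduction at `2` ⟹ `4 ∣ b₂`, `2 ∣ b₄`, `2 ∤ b₆`** on the integral minimal model (`b₂ = a₁² + 4a₂`, `b₄ = 2a₄ + a₁a₃`,
`b₆ = a₃² + 4a₆` with `a₁` even, `a₃` odd). [cite: SilvermanAEC2009, III.1] -/
theorem b_parity_of_goodSS (hss : Literature.NumberTheory.EllipticCurves.Rank1Residual.GoodSS W 2) :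
    (4 : ℤ) ∣ (integralModelInt W).b₂ ∧ (2 : ℤ) ∣ (integralModelInt W).b₄ ∧ ¬ (2 : ℤ) ∣ (integralModelInt W).b₆ := by
  obtain ⟨α, hα⟩ := two_dvd_a₁_of_goodSS W hss
  have ha3 := not_two_dvd_a₃_of_goodSS W hss
  set M : WeierstrassCurve ℤ := integralModelInt W with hM
  refine ⟨⟨α ^ 2 + M.a₂, by rw [WeierstrassCurve.b₂, hα]; ring⟩, ⟨M.a₄ + α * M.a₃, by rw [WeierstrassCurve.b₄, hα]; ring⟩, ?_⟩
  rintro ⟨k, hk⟩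
  apply ha3
  -- `b₆ = a₃² + 4a₆` even forces `a₃` even
  have hsq : (2 : ℤ) ∣ M.a₃ ^ 2 := ⟨k - 2 * M.a₆, by rw [WeierstrassCurve.b₆] at hk; linarith⟩
  exact Int.Prime.dvd_pow' (by norm_num) hsq

end Parity

/-! ## §2 The `2`-division cubic with `4 ∣ b₂`, `2 ∣ b₄`, `2 ∤ b₆` has no `2`-adic root -/

/-- **Ultrametric no-root lemma.**  For integers with `4 ∣ b₂`, `2 ∣ b₄`, `2 ∤ b₆` and every `x ∈ ℚ₂`:
`4x³ + b₂x² + 2b₄x + b₆ ≠ 0`.  If `‖x‖ ≤ 1` the three `x`-terms have norm `≤ ¼ < 1 = ‖b₆‖`; if `‖x‖ ≥ 2` then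
`‖4x³‖ = ¼‖x‖³` strictly exceeds `¼‖x‖² ≥ ‖b₂x²‖`, `¼‖x‖ ≥ ‖2b₄x‖` and `1 = ‖b₆‖`. [cite: SilvermanAEC2009, VII.3 (proof of Prop. 3.1)] -/
theorem twoDivisionCubic_ne_zero_of_dvd {b₂ b₄ b₆ : ℤ} (h2 : (4 : ℤ) ∣ b₂) (h4 : (2 : ℤ) ∣ b₄) (h6 : ¬ (2 : ℤ) ∣ b₆) (x : ℚ_[2]) :
    4 * x ^ 3 + (b₂ : ℚ_[2]) * x ^ 2 + 2 * (b₄ : ℚ_[2]) * x + (b₆ : ℚ_[2]) ≠ 0 := by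
  haveI : Fact (Nat.Prime 2) := ⟨Nat.prime_two⟩
  intro hx
  -- norms of the coefficients
  have hn2 : ‖(2 : ℚ_[2])‖ = 1 / 2 := by
    have := Padic.norm_p (p := 2); norm_num at this ⊢; exact_mod_cast this
  have hn4 : ‖(4 : ℚ_[2])‖ = 1 / 4 := by
    rw [show (4 : ℚ_[2]) = 2 * 2 by norm_num, norm_mul, hn2]; norm_num
  have hint : ∀ m : ℤ, ‖(m : ℚ_[2])‖ ≤ 1 := fun m ↦ Padic.norm_int_le_one (p := 2) m
  obtain ⟨c, hc⟩ := h2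
  obtain ⟨d, hd⟩ := h4
  have hb₂ : ‖(b₂ : ℚ_[2])‖ ≤ 1 / 4 := by
    rw [hc]; push_cast; rw [norm_mul, hn4]
    nlinarith [hint c, norm_nonneg (c : ℚ_[2])]
  have hb₄ : ‖(2 * (b₄ : ℚ_[2]))‖ ≤ 1 / 4 := by
    rw [hd]; push_cast; rw [show (2 : ℚ_[2]) * (2 * (d : ℚ_[2])) = 4 * d by ring, norm_mul, hn4]
    nlinarith [hint d, norm_nonneg (d : ℚ_[2])]
  have hb₆ : ‖(b₆ : ℚ_[2])‖ = 1 := by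
    rw [show (b₆ : ℚ_[2]) = ((b₆ : ℤ_[2]) : ℚ_[2]) by simp, ← PadicInt.norm_def]
    apply PadicInt.isUnit_iff.mp
    by_contra hnu
    have hm : (b₆ : ℤ_[2]) ∈ RingHom.ker (PadicInt.toZMod (p := 2)) := by
      rw [PadicInt.ker_toZMod]; exact (IsLocalRing.mem_maximalIdeal _).mpr hnu
    rw [RingHom.mem_ker, map_intCast, ZMod.intCast_zmod_eq_zero_iff_dvd] at hm
    exact h6 (by exact_mod_cast hm)
  -- ultrametric sums
  have hultra : ∀ a b : ℚ_[2], ‖a + b‖ ≤ max ‖a‖ ‖b‖ := Padic.nonarchimedean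
  have hsum_lt : ∀ {t₁ t₂ t₃ : ℚ_[2]} {c : ℝ}, ‖t₁‖ < c → ‖t₂‖ < c → ‖t₃‖ < c → ‖t₁ + t₂ + t₃‖ < c :=
    fun h₁ h₂ h₃ ↦ lt_of_le_of_lt (hultra _ _) (max_lt (lt_of_le_of_lt (hultra _ _) (max_lt h₁ h₂)) h₃)
  have hne : ∀ {a b : ℚ_[2]}, ‖b‖ < ‖a‖ → a + b ≠ 0 := by
    intro a b h hab
    have : a = -b := eq_neg_of_add_eq_zero_left hab
    rw [this, norm_neg] at h
    exact lt_irrefl _ h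
  rcases le_or_gt ‖x‖ 1 with hx1 | hx1
  · -- `‖x‖ ≤ 1`: the constant `b₆` dominates
    refine hne (a := (b₆ : ℚ_[2])) (b := 4 * x ^ 3 + (b₂ : ℚ_[2]) * x ^ 2 + 2 * (b₄ : ℚ_[2]) * x) ?_ (by rw [← hx]; ring)
    rw [hb₆]
    refine hsum_lt ?_ ?_ ?_
    · rw [norm_mul, hn4, norm_pow]
      calc (1 / 4 : ℝ) * ‖x‖ ^ 3 ≤ 1 / 4 * 1 ^ 3 := by gcongr
        _ < 1 := by norm_num
    · rw [norm_mul, norm_pow]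
      calc ‖(b₂ : ℚ_[2])‖ * ‖x‖ ^ 2 ≤ 1 / 4 * 1 ^ 2 := by gcongr
        _ < 1 := by norm_num
    · rw [norm_mul]
      calc ‖(2 * (b₄ : ℚ_[2]))‖ * ‖x‖ ≤ 1 / 4 * 1 := by gcongr
        _ < 1 := by norm_num
  · -- `‖x‖ > 1`, hence `‖x‖ ≥ 2`: the leading term dominates
    have hx2 : (2 : ℝ) ≤ ‖x‖ := by
      have h := (Padic.norm_le_pow_iff_norm_lt_pow_add_one x 0).not
      simp only [zpow_zero, zero_add, zpow_one, not_le, not_lt] at h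
      -- `‖x‖ > 1 = 2^0` ⟹ `¬ ‖x‖ < 2^1` ⟹ `2 ≤ ‖x‖`
      have : ¬ ‖x‖ < 2 := fun hlt ↦ absurd ((Padic.norm_le_pow_iff_norm_lt_pow_add_one x 0).mpr (by simpa using hlt))
        (by simpa using hx1)
      exact_mod_cast (not_lt.mp this)
    have hxpos : (0 : ℝ) < ‖x‖ := lt_trans zero_lt_one hx1
    refine hne (a := 4 * x ^ 3) (b := (b₂ : ℚ_[2]) * x ^ 2 + 2 * (b₄ : ℚ_[2]) * x + (b₆ : ℚ_[2])) ?_ (by rw [← hx]; ring)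
    rw [norm_mul, hn4, norm_pow]
    refine hsum_lt ?_ ?_ ?_
    · rw [norm_mul, norm_pow]
      calc ‖(b₂ : ℚ_[2])‖ * ‖x‖ ^ 2 ≤ 1 / 4 * ‖x‖ ^ 2 := by gcongr
        _ < 1 / 4 * ‖x‖ ^ 3 := by
          have : ‖x‖ ^ 2 < ‖x‖ ^ 3 := pow_lt_pow_right₀ hx1 (by norm_num)
          linarith
    · rw [norm_mul]
      calc ‖(2 * (b₄ : ℚ_[2]))‖ * ‖x‖ ≤ 1 / 4 * ‖x‖ := by gcongr
        _ < 1 / 4 * ‖x‖ ^ 3 := by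
          have : ‖x‖ ^ 1 < ‖x‖ ^ 3 := pow_lt_pow_right₀ hx1 (by norm_num)
          rw [pow_one] at this
          linarith
    · rw [hb₆]
      have h8 : (2 : ℝ) ^ 3 ≤ ‖x‖ ^ 3 := by gcongr
      linarith

/-! ## §3 ★ `E(ℚ₂)[2] = 0` for good supersingular reduction at `2` -/

section NoTwoTorsion

variable (W : WeierstrassCurve ℚ) [W.IsElliptic] [W.IsGloballyMinimal]

/-- ★ **Good supersingular reduction at `2` ⟹ `E(ℚ₂)` has no point of order `2`** (`∀ Q ∈ E(ℚ₂), 2Q = O → Q = O`, over Mathlib's `ℚ_[2]`):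
`#E(ℚ₂)[2] = #{ℚ₂-roots of ψ₂} + 1` and `ψ₂ = 4x³ + b₂x² + 2b₄x + b₆` (integral minimal model) has no `2`-adic root by §1–§2.
Equivalently `ℚ₂(E[2])/ℚ₂` is an `S₃`-extension (the three `2`-torsion points have `v(x) = −2/3`).
[cite: SilvermanAEC2009, III.1 and VII.3 Prop. 3.1] [cite: MilneADT2006, I Lemma 3.3] -/
theorem forall_two_nsmul_eq_zero_padic_of_goodSS (hss : Literature.NumberTheory.EllipticCurves.Rank1Residual.GoodSS W 2) :
    ∀ Q : (W.baseChange ℚ_[2]).toAffine.Point, 2 • Q = 0 → Q = 0 := by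
  haveI : Fact (Nat.Prime 2) := ⟨Nat.prime_two⟩
  obtain ⟨h2, h4, h6⟩ := b_parity_of_goodSS W hss
  -- the root set of `ψ₂` over `ℚ₂` is empty
  have hroots : {x : ℚ_[2] | (W.baseChange ℚ_[2]).twoTorsionPolynomial.toPoly.IsRoot x} = ∅ := by
    refine Set.eq_empty_of_forall_notMem fun x hx ↦ ?_
    rw [Set.mem_setOf_eq, GenusKolyTwin.isRoot_twoTorsionPolynomial_baseChange_padic_iff W] at hx
    exact twoDivisionCubic_ne_zero_of_dvd h2 h4 h6 x hx
  have hcard : Nat.card (AddSubgroup.torsionBy (W.baseChange ℚ_[2]).toAffine.Point (2 : ℤ)) = 1 := by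
    rw [WeierstrassCurve.natCard_torsionBy_two_eq _ (two_ne_zero' ℚ_[2]), hroots, Set.ncard_empty]
  intro Q hQ
  have hQmem : Q ∈ AddSubgroup.torsionBy (W.baseChange ℚ_[2]).toAffine.Point (2 : ℤ) := by
    rw [Submodule.mem_toAddSubgroup, Submodule.mem_torsionBy_iff, two_zsmul, ← two_nsmul]
    exact hQ
  haveI : Finite (AddSubgroup.torsionBy (W.baseChange ℚ_[2]).toAffine.Point (2 : ℤ)) :=
    Nat.finite_of_card_ne_zero (by rw [hcard]; exact one_ne_zero)
  have huniq := (Nat.card_eq_one_iff_unique.mp hcard).1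
  have h0 : (⟨Q, hQmem⟩ : AddSubgroup.torsionBy (W.baseChange ℚ_[2]).toAffine.Point (2 : ℤ)) = ⟨0, zero_mem _⟩ :=
    huniq.elim _ _
  exact congrArg Subtype.val h0

/-- **The same in the place currency of the Selmer files: `#ker(2 : E(ℚ_{v₂}) → E(ℚ_{v₂})) = 1`** at the place `v₂ ∋ 2` of `ℚ`
(transport `ℚ_{v₂} ≅ ℚ₂`, tree `natCard_ker_nsmul_adicCompletion_eq_one_iff`). [cite: MilneADT2006, I Lemma 3.3] -/
theorem natCard_ker_two_adicCompletion_eq_one_of_goodSS (hss : Literature.NumberTheory.EllipticCurves.Rank1Residual.GoodSS W 2)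
    (v₂ : HeightOneSpectrum (𝓞 ℚ)) (hv₂ : ((2 : ℕ) : 𝓞 ℚ) ∈ v₂.asIdeal) :
    Nat.card (nsmulAddMonoidHom 2 : (W.baseChange (v₂.adicCompletion ℚ)).toAffine.Point →+ _).ker = 1 := by
  haveI : Fact (Nat.Prime 2) := ⟨Nat.prime_two⟩
  exact (W.natCard_ker_nsmul_adicCompletion_eq_one_iff (p := 2) (v := v₂) (by exact_mod_cast hv₂) 2).mpr
    (forall_two_nsmul_eq_zero_padic_of_goodSS W hss)

/-- **Hence `#𝓛₂ = 2` on the good-supersingular cell** (`#𝓛_v = #E(K_v)[n]·#(𝓞_v/n)`): the hypothesis of the STRICT-or-FULL dichotomy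
(p784198 §6) is discharged. [cite: MilneADT2006, Ch. I, Lemma 3.3] -/
theorem natCard_kummerSelmerStructure_two_eq_two_of_goodSS (hss : Literature.NumberTheory.EllipticCurves.Rank1Residual.GoodSS W 2)
    (v₂ : HeightOneSpectrum (𝓞 ℚ)) (hv₂ : ((2 : ℕ) : 𝓞 ℚ) ∈ v₂.asIdeal) :
    Nat.card (W.kummerSelmerStructure ((2 : ℕ) : ℤ) (Sum.inr v₂)) = 2 :=
  natCard_kummerSelmerStructure_two_eq_two W v₂ hv₂ (natCard_ker_two_adicCompletion_eq_one_of_goodSS W hss v₂ hv₂)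

end NoTwoTorsion

/-! ## §4 ★★★ The sharp 2-adic bit on the good-supersingular off-cut cell, binder `E(ℚ₂)[2] = 0` discharged -/

/-- ★★★ **THE SHARP BIT ON THE PEN'S F4ˢˢ / T_C HABITAT.**  `E = W/ℚ` globally minimal, `C(E)` odd, no odd multiplicative prime, `Δ_E < 0`,
`ρ_{E,2^n}` onto, GOOD SUPERSINGULAR at `2`; `K` a `2`-split Heegner frame (`d_K` odd, the two non-squares, Heegner, `2` split).  Then
**`(NPh_M ∀M)(E, K)` ⟺ «`Sel₂(E)` is 2-adically STRICT at `v₂` AND every non-zero phantom has `res_{v₂} ≠ 0`»** — p784198's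
`nonPhantom_pow_iff_strict_and_forall_localization_ne_zero` with `E(ℚ₂)[2] = 0` supplied by §3.  (By the paper lemma LPF₂ — level-4 phantoms
are flat at a supersingular `2`, REF1 §386 — the right-hand side is always false on this cell; that input is NOT a kernel theorem here.)
BSD is NOT proved by this; nothing is closed. [cite: LawsonWuthrich2016, §3, §7.1, §8] [cite: MilneADT2006, Ch. I, Thm. 4.10 (b), Lemma 3.3] -/
theorem nonPhantom_pow_iff_strict_and_forall_localization_ne_zero_of_goodSS
    (W : WeierstrassCurve ℚ) [W.IsElliptic] [W.IsGloballyMinimal] [NeZero (W.conductorNorm ℤ)] {K : Type} [Field K] [NumberField K]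
    (hρ : ∀ n : ℕ, 0 < n → W.HasSurjectiveModNGaloisRep ((2 : ℤ) ^ n)) (hT : Odd W.tamagawaProduct)
    (hoff : ¬ ∃ v : HeightOneSpectrum (𝓞 ℚ), ((2 : ℕ) : 𝓞 ℚ) ∉ v.asIdeal ∧ ((W.conductorNorm ℤ : ℕ) : 𝓞 ℚ) ∈ v.asIdeal ∧
      W.HasMultiplicativeReductionAt v)
    (hneg : W.Δ < 0) (hss : Literature.NumberTheory.EllipticCurves.Rank1Residual.GoodSS W 2)
    (v₂ : HeightOneSpectrum (𝓞 ℚ)) (hv₂ : ((2 : ℕ) : 𝓞 ℚ) ∈ v₂.asIdeal)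
    (hK : IsImaginaryQuadratic K) (hodd : Odd (NumberField.discr K)) (hnsq₁ : ¬ IsSquare ((NumberField.discr K : ℚ) * -|W.Δ|))
    (hnsq₂ : ¬ IsSquare ((NumberField.discr K : ℚ) * (-(2 * |W.Δ|))))
    (hH : SatisfiesHeegnerHypothesis (W.conductorNorm ℤ) K) (h2K : ((Ideal.span {(2 : ℤ)}).primesOver (𝓞 K)).ncard = 2) :
    (∀ (Mlev : ℕ), 1 ≤ Mlev → ∀ z : galH1Torsion (W.baseChange K) ((2 ^ Mlev : ℕ) : ℤ),
        (∀ ρ ∈ torsionFixing (W.baseChange K) ((2 ^ Mlev : ℕ) : ℤ), h1Eval (W.baseChange K) ((2 ^ Mlev : ℕ) : ℤ) z ρ = 0) →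
        (∀ w : HeightOneSpectrum (𝓞 K), ((2 * W.conductorNorm ℤ : ℕ) : 𝓞 K) ∈ w.asIdeal →
          z ∈ selmerLocalKer (W.baseChange K) (w.adicCompletion K) ((2 ^ Mlev : ℕ) : ℤ)) → z = 0) ↔
      (∀ s ∈ W.selmerGroup ((2 : ℕ) : ℤ), galoisCohomology.localization (W.torsionGaloisModule ((2 : ℕ) : ℤ)) (Sum.inr v₂) 1 s = 0) ∧
        ∀ x : galH1Torsion W (2 : ℤ), x ≠ 0 → (∀ h ∈ torsionFixing W (4 : ℤ), h1Eval W (2 : ℤ) x h = 0) →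
          galoisCohomology.localization (W.torsionGaloisModule ((2 : ℕ) : ℤ)) (Sum.inr v₂) 1 x ≠ 0 :=
  nonPhantom_pow_iff_strict_and_forall_localization_ne_zero W hρ hT hoff hneg v₂ hv₂
    (natCard_ker_two_adicCompletion_eq_one_of_goodSS W hss v₂ hv₂) hK hodd hnsq₁ hnsq₂ hH h2K

end Summit.BirchSwinnertonDyer.BirchSwinnertonDyer.Theorems.GenusExact.Lw2PhantomExclusion.TwoAdic

end
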